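import Mathlib
import HarnessLib
import Summits.QuantumAdvantage.QuantumAdvantage.Theses.PathInvolution

/-!
# Line `birth` — BC3 skeleton for the crux `PinvTarget` (stmt-QuantumAdvantage-2012)

Route `PathInvolution` (route-QuantumAdvantage-PathInvolution; NEGATION side — the deciding theorem is
`closes (hC : PinvCriterion) (hT : PinvTarget) : ¬ QuantumAdvantage`). The crux (rank 0, auto-crux, the
route's thesis X, EXPECTED FALSE and filed so that both sides have typed objects to shoot at):

  `PinvTarget` := for the dephased (coin-flip) chain `ust` of a Toffoli+H gate list, every `L ∈ BQP` is
  decided with gap `(2/3, 1/3)` by a poly-time-uniform oracle-free `{H, X, CNOT, TOF}` family whose total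
  REACHABLE HADAMARD INFLUENCE is `≤ 1/10` on every input.

## The line: cut X along Shi's FOURIER HIERARCHY (Shi2005 §4, `FH_k` = languages decided with bounded
error by uniform poly-size Toffoli+Hadamard circuits with `≤ k` layers of Hadamards; `FH₀ = P`,
`FH₁ = BPP`, Factoring ∈ `FH₂` via Kitaev's phase estimation; Conjecture 4.1: `FH_k ⊊ FH_{k+1}`).

Hadamards of the FIRST round of a Toffoli+H circuit act on classically determined wires (the dephased
walk from `|x 0…0⟩` is a single trajectory until the first coin on each wire), so by the crux's
reachability refinement they carry ZERO influence: the route's own calibration `PinvCalibration` is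
"`BPP = FH₁` = influence-free Toffoli+H". Influence is born at the SECOND round. The skeleton therefore
factors X through the first nontrivial level of the hierarchy:

* `stub_toffoliHDecidesBQP` (L, TRUE — Shi 2003 / Aharonov 2003; in the tree's language: realification
  with one flag wire, `BQPOver_subset_BQPOver_realify` / `BQP_subset_BQPOver_adhRealGateSet` (proved),
  then a sound, uniformly substitutable APPROXIMATE `GateCompiler` of the real gates into `toffoliH`
  (density of Toffoli+H placements in the orthogonal group, Shi2003; Solovay–Kitaev as in the tree's
  `solovay_kitaev_holds` / `PlacementSolovayKitaev.exists_placementWord`, DawsonNielsen2006) and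
  `BQPWith_subset_BQPWith_of_compiler` with the slack of `BQP_eq_BQPWith`; NOT an exact compiler: by
  AmyGlaudellRoss2020 Cor. (i) a matrix is exactly a `{X, CX, CCX, H}`+ancilla circuit iff it is
  `W/√2^q` with `W` integral, which the realified `T` gate `Λ(R_{π/4})` (entries `1` and `±1/√2`) is not):
  every `BQP` language is decided with gap `(2/3, 1/3)` by a uniform oracle-free Toffoli+H family
  (`BQP ⊆ BQPOver toffoliH`, spelled with the crux's inline `Encodable` instance).
* `stub_twoRoundCollapse` (OPEN — the negation of Shi's Conjecture 4.1 above level 2, i.e.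
  `BQP ⊆ FH₂`, stated inside Toffoli+H): every uniform oracle-free Toffoli+H decider of a language `L`
  can be replaced by one whose Hadamard gates form at most TWO ROUNDS (two blocks of consecutive `H`
  gates = two Fourier transforms over `ℤ₂^m`; all other gates `X/CNOT/TOF`). Implied by `¬S`
  (`BQP ⊆ BPP = FH₁`), not known, not refutable today (a refutation proves `FH₁ ≠ BQP`, i.e. S).
* `stub_twoRoundLowInfluence` (EXPECTED FALSE, strictly below X — "dequantize the second Fourier
  round": with the route's criterion `PinvCriterion` it gives `FH₂ ⊆ BPP`, against Simon/Kitaev–Shor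
  (Shi2005 §4) and the `FH₂` supremacy results (arXiv:1711.10605)): every TWO-ROUND uniform oracle-free
  Toffoli+H decider of `L` can be replaced by a uniform oracle-free Toffoli+H decider of `L` with
  reachable Hadamard influence `≤ 1/10` (the crux's fourth conjunct verbatim).
* Composition `PinvTarget_of` (sorry-free, 5 lines): `L ∈ BQP` ↦ Toffoli+H decider ↦ two-round decider
  ↦ low-influence decider; the conclusion is the route decl `PinvTarget` BY NAME.

Why this cut and not `BQP ⊆ BPP` + `PinvCalibration`: the latter's first piece is `¬QuantumAdvantage`
verbatim (costume). Here no stub is the crux or the summit in other clothes: stub 1 is a theorem in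
print, stub 2 is a structural collapse with no dequantization content (it does not mention `BPP`,
influence or `ust`), stub 3 is the crux restricted to the first level of the hierarchy where influence
exists at all; `stub₂ ∧ stub₃` is the crux's content split at `FH₂`, exactly as `FH₁ ⊆ FH₂ ⊆ BQP`
splits `BPP` vs `BQP` (Shi2005 Conj. 4.1 at `k = 1` vs `k ≥ 2`).

Disproof used: none exists for this crux at registration (`ledger crux ls stmt-QuantumAdvantage-2012`:
no workfiles, no `Disproof.lean`, no `Negative/` lemmas). Negatives index (`ledger negatives --problem
QuantumAdvantage`, 2026-08-17: 6 refuted statements — RegulatorThird, ShorLocallyDark, CubicStability,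
SpinorFlattening/GaussRankPoly, KummerSector, SeparableFrames): none concerns gate-set compilation,
Hadamard rounds or Hadamard influence, so no stub restates a refuted statement.
BC3 probes (planner folder `bc/PinvTarget_probe_stub*.lean`, statements inlined,
`first | exact? | simpa | aesop` and the extended BC2 combinator, `maxHeartbeats 400000`):
`stubᵢ → PinvTarget`, `stubᵢ → QuantumAdvantage` (and `stubᵢ → ¬QuantumAdvantage`, `example : stubᵢ`)
FAIL for all three stubs — see the planner's NOTES.md `birth-certificate:` block for rc and goals.
`sorry` occurs ONLY in the three `stub_*` theorems.
-/

set_option linter.dupNamespace false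
set_option linter.unusedVariables false

noncomputable section

namespace Summit.QuantumAdvantage.QuantumAdvantage.Cruxes.PinvTarget.Birth

open scoped BigOperators Classical Matrix
open Literature.Computability.Cryptography Literature.Computability.QuantumComplexity

/-! ## The objects of the crux, named (verbatim sub-terms of the route decl `PinvTarget`) -/

/-- `ust` IS the dephased (coin-flip) chain: the product of the entrywise-`|·|²` (unistochastic) gate
matrices of a Toffoli+H gate list — verbatim the characterising hypothesis of the crux. [folklore] -/
def IsDephasedChain
    (ust : {M : ℕ} → List (Literature.Computability.Cryptography.QGate Literature.Computability.Cryptography.toffoliH M) → Matrix (Literature.Computability.Cryptography.QReg M) (Literature.Computability.Cryptography.QReg M) ℝ) : Prop :=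
  ∀ (M : ℕ) (L : List (Literature.Computability.Cryptography.QGate Literature.Computability.Cryptography.toffoliH M)), ust L = (L.map fun g => (g.toMatrix 0).map fun a : ℂ => ‖a‖ ^ 2).reverse.prod

/-- Poly-time uniformity of a Toffoli+H family, with the crux's inline `Encodable` instance (definitionally
the instance `instEncodableOpToffoliH` of `ToffoliHEncodable.lean`). [folklore] -/
def IsUniformTH (F : QCircuitFamily toffoliH) : Prop :=
  @Literature.Computability.Cryptography.QCircuitFamily.IsUniform Literature.Computability.Cryptography.toffoliH (inferInstanceAs (Encodable Literature.Computability.Cryptography.ToffoliHOp)) F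

/-- `F` decides `L` with gap `(2/3, 1/3)` on output wire `0` — verbatim the crux's third conjunct.
[cite: BernsteinVazirani1997, Def. 8] -/
def Decides (F : QCircuitFamily toffoliH) (L : Language Bool) : Prop :=
  ∀ x, (x ∈ L → 2 / 3 ≤ F.acceptProbOn 0 x) ∧ (x ∉ L → F.acceptProbOn 0 x ≤ 1 / 3)

/-- Total REACHABLE HADAMARD INFLUENCE `≤ 1/10` on every input (w.r.t. the chain `ust`) — verbatim the
crux's fourth conjunct: a profile `κ ≥ 0` with `Σ_j κ_j ≤ 1/10` dominating half the dephased
output-sensitivity of every Hadamard `j` (wire `w`) over the pairs `s, s ⊕ e_w` that are BOTH reachable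
from `|x 0…0⟩` before gate `j`. [folklore] -/
def LowInfluence
    (ust : {M : ℕ} → List (Literature.Computability.Cryptography.QGate Literature.Computability.Cryptography.toffoliH M) → Matrix (Literature.Computability.Cryptography.QReg M) (Literature.Computability.Cryptography.QReg M) ℝ)
    (F : QCircuitFamily toffoliH) : Prop :=
  ∀ x : List Bool, ∃ κ : ℕ → ℝ, (∀ j, 0 ≤ κ j) ∧ (∑ j ∈ Finset.range (F.circ x.length).gates.length, κ j) ≤ 1 / 10 ∧ ∀ (j : ℕ) (hj : j < (F.circ x.length).gates.length) (w : Fin (x.length + F.ancillas x.length)) (s : Literature.Computability.Cryptography.QReg (x.length + F.ancillas x.length)), (F.circ x.length).gates.get ⟨j, hj⟩ = Literature.Computability.Cryptography.QGate.gate Literature.Computability.Cryptography.ToffoliHOp.H (Literature.Computability.QuantumComplexity.wireEmb w) → 0 < ust ((F.circ x.length).gates.take j) s (Literature.Computability.Cryptography.padInput x.get (F.ancillas x.length)) → 0 < ust ((F.circ x.length).gates.take j) (Function.update s w (!s w)) (Literature.Computability.Cryptography.padInput x.get (F.ancillas x.length)) → |(∑ y, if y ∈ Literature.Computability.Cryptography.QCircuit.acceptEvent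 (x.length + F.ancillas x.length) then ust ((F.circ x.length).gates.drop (j + 1)) y (Function.update s w false) else 0) - (∑ y, if y ∈ Literature.Computability.Cryptography.QCircuit.acceptEvent (x.length + F.ancillas x.length) then ust ((F.circ x.length).gates.drop (j + 1)) y (Function.update s w true) else 0)| ≤ 2 * κ j

/-- AT MOST TWO HADAMARD ROUNDS (Shi2005 §4: two Fourier transforms): for every input length the indices
of the Hadamard gates of `F.circ n` are exactly two (possibly empty) intervals `[a, b) ∪ [c, d)` of
consecutive gates — a block of consecutive `H` gates is one Fourier transform over `ℤ₂^m` (repeated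
wires cancel), every other gate is `X`, `CNOT` or `TOF`. Every arity-1 placement is a `wireEmb`, so the
left side detects all `H` gates. [cite: Shi2005, §4] -/
def TwoHadamardRounds (F : QCircuitFamily toffoliH) : Prop :=
  ∀ n : ℕ, ∃ a b c d : ℕ, a ≤ b ∧ b ≤ c ∧ c ≤ d ∧
    ∀ (j : ℕ) (hj : j < (F.circ n).gates.length),
      (∃ w : Fin (n + F.ancillas n),
          (F.circ n).gates.get ⟨j, hj⟩ = QGate.gate ToffoliHOp.H (wireEmb w)) ↔
        (a ≤ j ∧ j < b) ∨ (c ≤ j ∧ j < d)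

/-! ## The three stub statements, named -/

/-- **Stub 1 statement — Toffoli+H decides `BQP`** (`BQP ⊆ BQPOver toffoliH` with the crux's
conventions): every `BQP` language (uniform Clifford+T, error `1/3`) is decided with gap `(2/3, 1/3)`
by a poly-time-uniform oracle-free `{H, X, CNOT, TOF}` family. TRUE (Shi 2003; Aharonov 2003).
[cite: Shi2003] -/
def ToffoliHDecidesBQP : Prop :=
  ∀ L ∈ Literature.Computability.Cryptography.BQP,
    ∃ F : QCircuitFamily toffoliH, F.IsOracleFree ∧ IsUniformTH F ∧ Decides F L

/-- **Stub 2 statement — collapse to two Hadamard rounds** (`BQPOver toffoliH ⊆ FH₂`; the negation of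
Shi's Conjecture 4.1 above level 2): a uniform oracle-free Toffoli+H decider of `L` can be replaced by a
uniform oracle-free Toffoli+H decider of `L` with at most two Hadamard rounds. OPEN. [cite: Shi2005, §4] -/
def TwoRoundCollapse : Prop :=
  ∀ F : QCircuitFamily toffoliH, F.IsOracleFree → IsUniformTH F →
    ∀ L : Language Bool, Decides F L →
      ∃ F' : QCircuitFamily toffoliH, F'.IsOracleFree ∧ IsUniformTH F' ∧ Decides F' L ∧
        TwoHadamardRounds F'

/-- **Stub 3 statement — the second Fourier round has avoidable influence** (the crux restricted to
`FH₂`): for the dephased chain `ust`, a TWO-ROUND uniform oracle-free Toffoli+H decider of `L` can be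
replaced by a uniform oracle-free Toffoli+H decider of `L` of reachable Hadamard influence `≤ 1/10`.
EXPECTED FALSE (with `PinvCriterion` it puts `FH₂`, hence Kitaev–Shor factoring, in `BPP`).
[cite: Shi2005, §4] -/
def TwoRoundLowInfluence : Prop :=
  ∀ (ust : {M : ℕ} → List (Literature.Computability.Cryptography.QGate Literature.Computability.Cryptography.toffoliH M) → Matrix (Literature.Computability.Cryptography.QReg M) (Literature.Computability.Cryptography.QReg M) ℝ),
    IsDephasedChain ust →
    ∀ F : QCircuitFamily toffoliH, F.IsOracleFree → IsUniformTH F → TwoHadamardRounds F →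
      ∀ L : Language Bool, Decides F L →
        ∃ F' : QCircuitFamily toffoliH, F'.IsOracleFree ∧ IsUniformTH F' ∧ Decides F' L ∧
          LowInfluence ust F'

/-! ## Sanity: the named pieces reassemble the crux definitionally -/

/-- The crux, unfolded into the named pieces (definitional — checks that the sub-terms are verbatim). [folklore] -/
theorem pinvTarget_iff :
    Summit.QuantumAdvantage.QuantumAdvantage.Theses.PathInvolution.PinvTarget ↔
      ∀ (ust : {M : ℕ} → List (Literature.Computability.Cryptography.QGate Literature.Computability.Cryptography.toffoliH M) → Matrix (Literature.Computability.Cryptography.QReg M) (Literature.Computability.Cryptography.QReg M) ℝ),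
        IsDephasedChain ust → ∀ L ∈ Literature.Computability.Cryptography.BQP,
          ∃ F : QCircuitFamily toffoliH, F.IsOracleFree ∧ IsUniformTH F ∧ Decides F L ∧
            LowInfluence ust F :=
  Iff.rfl

/-- The predicate `TwoHadamardRounds` computes: the empty family has (zero, hence at most) two rounds. [folklore] -/
example : TwoHadamardRounds ⟨fun _ => 0, fun _ => ⟨[]⟩⟩ := by
  intro n
  exact ⟨0, 0, 0, 0, le_rfl, le_rfl, le_rfl, fun j hj => absurd hj (Nat.not_lt_zero j)⟩

/-! ## The three registered stubs (the ONLY `sorry`s of this file) -/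

/-- **STUB 1 (L, TRUE): Toffoli+H decides `BQP`.** Plan: `BQP ⊆ BQPOver adhRealGateSet`
(`BQP_subset_BQPOver_adhRealGateSet`, proved: realification with one flag wire preserves acceptance
probabilities and uniformity; the real gates are `R_θ^{±1}`, `Λ(R_θ^{±1})`, `CNOT`, `cos θ = 3/5`), then a
sound, uniformly substitutable approximate `GateCompiler adhRealGateSet toffoliH` — density of Toffoli+H
placements in the orthogonal group on `≥ 3` wires (Shi2003; Aharonov 2003) and a Solovay–Kitaev word
search with poly-time computable entries (`toffoliH_polyTimeEntries`) — fed to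
`BQPWith_subset_BQPWith_of_compiler` with the slack of error reduction `BQP_eq_BQPWith`
(`1/6 + 1/6 ≤ 1/3`). Warning: no EXACT compiler exists for the realified Clifford+T / ADH gates
(AmyGlaudellRoss2020 Cor. (i): exactly the matrices `W/√2^q`, `W` integral, are `{X, CX, CCX, H}`+ancilla
circuits; `Λ(R_{π/4})` and `R_θ`, `cos θ = 3/5`, are not of that form), so
`BQPWith_subset_BQPWith_of_exactCompiler` does not apply. Leans on: `BQPGateSetIndependence.lean`
(`GateCompiler`, `substFamily`, `UniformSubst`, `BQPWith_subset_BQPWith_of_compiler`),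
`CircuitRealification.lean`, `QuantumTuringADHRealGateSet.lean`, `EffectiveCompilation.lean` /
`PlacementSolovayKitaev.exists_placementWord`, `solovay_kitaev_holds`.
Sources: Shi2003, Aharonov 2003 (arXiv:quant-ph/0301040), AmyGlaudellRoss2020 (Thm., Cor. (i)),
DawsonNielsen2006 (Thm. 1). -/
theorem stub_toffoliHDecidesBQP : ToffoliHDecidesBQP := by
  sorry

/-- **STUB 2 (OPEN): collapse of uniform Toffoli+H deciders to two Hadamard rounds** (`BQP ⊆ FH₂`
inside Toffoli+H; contradicts Shi2005 Conjecture 4.1 for `k ≥ 2`; implied by `¬QuantumAdvantage` via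
`BQP ⊆ BPP = FH₁`; any proof is non-relativizing in spirit since iterated Simon / recursive Fourier
sampling are the conjectured oracle separators of the levels). Sources: Shi2005 §4 (Conj. 4.1),
BennettBernsteinBrassardVazirani1997 (recursive Fourier sampling), AaronsonAmbainis 2015 (k-fold
Forrelation, arXiv:1411.5729). -/
theorem stub_twoRoundCollapse : TwoRoundCollapse := by
  sorry

/-- **STUB 3 (EXPECTED FALSE — the residue of X at the first level where influence exists): two-round
deciders have influence-`1/10` equivalents.** With the route's `PinvCriterion` (low influence ⇒ `BPP`)
it yields `FH₂ ⊆ BPP = FH₁` (Shi2005 Conj. 4.1 at `k = 1`; Kitaev–Shor factoring and Simon-type period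
finding live in `FH₂`); with `PinvCalibration` it is implied by `¬QuantumAdvantage`. This is where a
disprover of X should aim: a two-round family whose second-round coins MUST sway the output.
Sources: Shi2005 §4, Stahlke2014 (Thm 8), Vandennest2011 (Cor. 3), arXiv:1711.10605. -/
theorem stub_twoRoundLowInfluence : TwoRoundLowInfluence := by
  sorry

/-! ## Name-keyed aliases of the stub statements (hypotheses of the composition) -/

namespace Registered

/-- Alias of stub 1's statement keyed by the registered stub name. -/
abbrev stub_toffoliHDecidesBQP : Prop := ToffoliHDecidesBQP

/-- Alias of stub 2's statement keyed by the registered stub name. -/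
abbrev stub_twoRoundCollapse : Prop := TwoRoundCollapse

/-- Alias of stub 3's statement keyed by the registered stub name. -/
abbrev stub_twoRoundLowInfluence : Prop := TwoRoundLowInfluence

end Registered

/-! ## Kernel-checked composition -/

/-- **COMPOSITION (real proof, no `sorry`): the three stubs give the crux `PinvTarget` BY NAME.**
Given the chain `ust` and `L ∈ BQP`: stub 1 gives a uniform oracle-free Toffoli+H decider, stub 2 flattens
it to two Hadamard rounds, stub 3 trades the two-round decider for one of reachable Hadamard influence
`≤ 1/10` w.r.t. `ust` — which is the crux's witness. [folklore] -/
theorem PinvTarget_of (h₁ : Registered.stub_toffoliHDecidesBQP) (h₂ : Registered.stub_twoRoundCollapse)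
    (h₃ : Registered.stub_twoRoundLowInfluence) :
    Summit.QuantumAdvantage.QuantumAdvantage.Theses.PathInvolution.PinvTarget := by
  intro ust hust L hL
  obtain ⟨F, hOF, hU, hD⟩ := id (α := ToffoliHDecidesBQP) h₁ L hL
  obtain ⟨F', hOF', hU', hD', hR'⟩ := id (α := TwoRoundCollapse) h₂ F hOF hU L hD
  obtain ⟨F'', hOF'', hU'', hD'', hκ⟩ := id (α := TwoRoundLowInfluence) h₃ ust hust F' hOF' hU' hR' L hD'
  exact ⟨F'', hOF'', hU'', hD'', hκ⟩

/-- Consistency check only (an `example`, so that no `sorry`-tainted proof of the crux enters the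
environment and a later `exact?` probe importing this file cannot pick up a fake proof of `PinvTarget`):
the composition typechecks against the stubs exactly as registered. -/
example : Summit.QuantumAdvantage.QuantumAdvantage.Theses.PathInvolution.PinvTarget :=
  PinvTarget_of stub_toffoliHDecidesBQP stub_twoRoundCollapse stub_twoRoundLowInfluence

end Summit.QuantumAdvantage.QuantumAdvantage.Cruxes.PinvTarget.Birth

end
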